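import Summits.HodgeConjecture.HodgeConjecture.Theorems.LinearSystemTorelliLocalTubeSpanAlgebra

/-!
# Route LinearSystemTorelli — crux `LocalTubeSpan`: cyclic detection depends only on the image group

Helper file (`--supports stmt-HodgeConjecture-2490`, line `Sketch`, cycle 3).  The crux ("local
Schnell theorem", C. Schnell, *Primitive cohomology and the tube mapping*, Math. Z. 268 (2010) §3,
§7) is reduced by the line to CYCLIC DETECTION — injectivity of Schnell's third map
`H¹(G, V) → ∏_{g ∈ G} V/(g - 1)V` — for the local fundamental group `G = G_{s₀}` acting on the
vanishing cohomology `V`.  Schnell's "relation erasure" (first paragraph of the proof of his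
Prop. 12; in the tree `localTubeSpan_injective_evalCoinv_res_iff_of_surjective`) says the property
descends along surjections.  This file draws the consequence the line's THIN BOUNDARY needs:

* `localTubeSpan_injective_evalCoinv_iff_of_range_eq` — cyclic detection for a representation
  `ρ : G → GL(V)` depends ONLY on the image `ρ(G) ⊆ End(V)`: two representations of possibly
  different groups on the same space with the same image have injective third maps simultaneously.

So LocalTubeSpan at a point `s₀` of the discriminant is a property of the LINEAR local monodromy
group `Γ_loc = ⟨T_δ : δ ∈ Δ_loc⟩ ≤ Sp(V)` generated by the Picard–Lefschetz transvections of the local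
vanishing cycles — pure lattice data `(V, B, Δ_loc)` — and the thin configuration of
`localTubeSpan_exists_thinConfiguration_not_injective` is a counterexample for EVERY group realising
its image.

References: [Schnell2010] C. Schnell, Primitive cohomology and the tube mapping, Math. Z. 268
(2010) §7 (proof of Prop. 12, first paragraph).
-/

-- `Summit.HodgeConjecture.HodgeConjecture.Theorems` is the mandated namespace (single-conjunct summit:
-- Sub = Summit), which `linter.dupNamespace` flags on every declaration; the lakefile turns the
-- linter off tree-wide (weak option), restated here so stand-alone elaboration is warning-free too.
set_option linter.dupNamespace false

noncomputable section

open CategoryTheory groupCohomology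
open Literature.AlgebraicGeometry.HodgeTheory

namespace Summit.HodgeConjecture.HodgeConjecture.Theorems

section Image

variable {V : Type} [AddCommGroup V] [Module ℚ V]

/-- Cyclic detection for a representation is equivalent to cyclic detection for the tautological
representation of its IMAGE `Γ = ρ(G) ≤ GL(V)` (relation erasure along `G ↠ Γ`). [folklore] -/
theorem localTubeSpan_injective_evalCoinv_iff_range {G : Type} [Group G]
    (ρ : Representation ℚ G V) :
    Function.Injective (evalCoinv (Rep.of ρ)) ↔
      Function.Injective (evalCoinv (Rep.of
        ((Units.coeHom (V →ₗ[ℚ] V)).comp (MonoidHom.range ρ.toHomUnits).subtype))) := by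
  set Γ : Subgroup (V →ₗ[ℚ] V)ˣ := MonoidHom.range ρ.toHomUnits
  set σ : Representation ℚ Γ V := (Units.coeHom (V →ₗ[ℚ] V)).comp Γ.subtype
  have hf : Function.Surjective (ρ.toHomUnits.rangeRestrict) := MonoidHom.rangeRestrict_surjective _
  have hres : Rep.res ρ.toHomUnits.rangeRestrict (Rep.of σ) = Rep.of ρ := rfl
  rw [← hres]
  exact localTubeSpan_injective_evalCoinv_res_iff_of_surjective _ (Rep.of σ) hf

/-- **Cyclic detection depends only on the image group.**  If two representations
`ρ : G → GL(V)`, `ρ' : G' → GL(V)` of (possibly different) groups on the same `ℚ`-space have the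
same image `ρ(G) = ρ'(G')`, then Schnell's third map `H¹(G, V) → ∏_g V/(g - 1)V` is injective iff
the one of `ρ'` is.  In the route: LocalTubeSpan at `s₀` is a property of the linear local
monodromy group `⟨T_δ : δ ∈ Δ_loc⟩ ≤ Sp(V)` of the local vanishing configuration, whatever the
presentation of the local fundamental group. [cite: Schnell2010, §7 (proof of Prop. 12)] -/
theorem localTubeSpan_injective_evalCoinv_iff_of_range_eq {G G' : Type} [Group G] [Group G']
    (ρ : Representation ℚ G V) (ρ' : Representation ℚ G' V) (h : Set.range ρ = Set.range ρ') :
    Function.Injective (evalCoinv (Rep.of ρ)) ↔ Function.Injective (evalCoinv (Rep.of ρ')) := by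
  have hΓ : MonoidHom.range ρ.toHomUnits = MonoidHom.range ρ'.toHomUnits := by
    ext u
    constructor
    · rintro ⟨g, rfl⟩
      obtain ⟨g', hg'⟩ : ρ g ∈ Set.range ρ' := h ▸ ⟨g, rfl⟩
      exact ⟨g', Units.ext (by simp [hg'])⟩
    · rintro ⟨g', rfl⟩
      obtain ⟨g, hg⟩ : ρ' g' ∈ Set.range ρ := h.symm ▸ ⟨g', rfl⟩
      exact ⟨g, Units.ext (by simp [hg])⟩
  rw [localTubeSpan_injective_evalCoinv_iff_range ρ, localTubeSpan_injective_evalCoinv_iff_range ρ',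
    hΓ]

end Image

end Summit.HodgeConjecture.HodgeConjecture.Theorems

end
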